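import Summits.RiemannHypothesis.RiemannHypothesis.Theorems.WeilWindowFlowWindowLipschitzStubCommutatorBoundAux
import Summits.RiemannHypothesis.RiemannHypothesis.Theorems.WeilWindowFlowWindowLipschitzStubSurplusReductionAux

/-!
# Edge law by cutting — the steep cutoff and the normalised ground state (RH-free)

Part of the pub-rhpf THEORY-2 programme (mechanism / rigidity of the Weil window bottom; no RH
claims). The IMS cut `(D)` of `WeilWindowFlowWindowLipschitzStubLocalizedCut` bounds
`(ε(a−h) − ε(a)) ‖χu‖²` by the commutator of a cutoff `χ`. Here the cutoff is STEEP: it vanishes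
at depth `a − |x| ≤ h`, ramps linearly on depths `[h, h + ℓ]` and equals `1` at depth `≥ H := h + ℓ`
(`steepCut (a − h) ℓ`); with `ℓ ≪ h` (eventually `ℓ = κ₂ h`) the commutator of a Weil ground state
is `≤ (1 + o(1)) · I · h`, `I` the edge intensity — the SHARP constant, where Stub E
(`…StubCommutatorBound`, ramp width `h`) only gives `O(h)`.

This file provides
* `steepCut` and its elementary properties (values in `[0,1]`, `(1/ℓ)`-Lipschitz, `= 0` / `= 1`
  regions, `(χ(x) − χ(y))² ≤ min(1, (x−y)²/ℓ²)`);
* `cut_normalise`: an a.e.-modification of a ground state that is measurable, vanishes off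
  `(−a, a)`, is bounded, and satisfies the pointwise edge law `‖u x‖² log(1/(a−|x|)) ≤ K_P`
  EVERYWHERE on the layer `0 < a − |x| < d₀`;
* two scalar lemmas for the pointwise majorant (`PfPersistenceEdgeLawCutMajorant`): Young's
  inequality in the form `PQ/(2t) ≤ (αP² + Q²/α)/(4t)` and `‖u y‖ ≤ √(K_P/L_s)` from the pointwise
  law at depth `≤ s`.

Sources: E. Bombieri, *Remarks on Weil's quadratic functional in the theory of prime numbers I*,
Rend. Mat. Acc. Lincei (9) 11 (2000) §4; H. Cycon, R. Froese, W. Kirsch, B. Simon, *Schrödinger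
Operators* (1987) Thm 3.2 (IMS localisation).
-/

set_option linter.dupNamespace false

noncomputable section

open MeasureTheory Set Filter
open scoped Topology ENNReal NNReal

namespace Summit.RiemannHypothesis.RiemannHypothesis.Theorems.PfPersistence

open Literature.NumberTheory.LFunctions
open Summit.RiemannHypothesis.RiemannHypothesis.Theorems.WeilWindowFlowWindowLipschitz

/-! ## The steep cutoff -/

/-- The steep cutoff with cut position `b` and ramp width `ℓ`:
`χ(x) = max(min((b − |x|)/ℓ, 1), 0)` (`= 0` for `|x| ≥ b`, `= 1` for `|x| ≤ b − ℓ`). [folklore] -/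
def steepCut (b ℓ x : ℝ) : ℝ := max (min ((b - |x|) / ℓ) 1) 0

/-- `0 ≤ χ ≤ 1`. [folklore] -/
theorem steepCut_mem (b ℓ x : ℝ) : 0 ≤ steepCut b ℓ x ∧ steepCut b ℓ x ≤ 1 :=
  ⟨le_max_right _ _, max_le (min_le_right _ _) zero_le_one⟩

/-- `χ(x) = 0` for `|x| ≥ b` (`ℓ > 0`). [folklore] -/
theorem steepCut_eq_zero {b ℓ x : ℝ} (hℓ : 0 < ℓ) (hx : b ≤ |x|) : steepCut b ℓ x = 0 := by
  have hp : (b - |x|) / ℓ ≤ 0 := by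
    rw [div_le_iff₀ hℓ, zero_mul]
    linarith
  exact max_eq_right ((min_le_left _ _).trans hp)

/-- `χ(x) = 1` for `|x| ≤ b − ℓ` (`ℓ > 0`). [folklore] -/
theorem steepCut_eq_one {b ℓ x : ℝ} (hℓ : 0 < ℓ) (hx : |x| ≤ b - ℓ) : steepCut b ℓ x = 1 := by
  have h1p : 1 ≤ (b - |x|) / ℓ := by
    rw [le_div_iff₀ hℓ]
    linarith
  unfold steepCut
  rw [min_eq_right h1p, max_eq_left (zero_le_one' ℝ)]

/-- `|χ(x) − χ(y)| ≤ |x − y|/ℓ`. [folklore] -/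
theorem abs_steepCut_sub_le {b ℓ : ℝ} (hℓ : 0 < ℓ) (x y : ℝ) :
    |steepCut b ℓ x - steepCut b ℓ y| ≤ |x - y| / ℓ := by
  calc |steepCut b ℓ x - steepCut b ℓ y|
      ≤ |min ((b - |x|) / ℓ) 1 - min ((b - |y|) / ℓ) 1| := abs_max_sub_max_le_abs _ _ _
    _ ≤ max |(b - |x|) / ℓ - (b - |y|) / ℓ| |(1 : ℝ) - 1| := abs_min_sub_min_le_max _ _ _ _
    _ = |(b - |x|) / ℓ - (b - |y|) / ℓ| := by
        rw [sub_self, abs_zero, max_eq_left (abs_nonneg _)]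
    _ = |(|y| - |x|)| / ℓ := by
        rw [show (b - |x|) / ℓ - (b - |y|) / ℓ = (|y| - |x|) / ℓ by ring, abs_div, abs_of_pos hℓ]
    _ ≤ |x - y| / ℓ := by
        rw [div_le_div_iff_of_pos_right hℓ, abs_sub_comm x y]
        exact abs_abs_sub_abs_le_abs_sub y x

/-- `χ` is `(1/ℓ)`-Lipschitz. [folklore] -/
theorem lipschitzWith_steepCut {b ℓ : ℝ} (hℓ : 0 < ℓ) :
    LipschitzWith (Real.toNNReal (1 / ℓ)) (steepCut b ℓ) := by
  refine LipschitzWith.of_dist_le_mul fun x y ↦ ?_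
  rw [Real.dist_eq, Real.dist_eq, Real.coe_toNNReal _ (by positivity)]
  calc |steepCut b ℓ x - steepCut b ℓ y| ≤ |x - y| / ℓ := abs_steepCut_sub_le hℓ x y
    _ = 1 / ℓ * |x - y| := by ring

/-- `χ` is continuous. [folklore] -/
theorem continuous_steepCut {b ℓ : ℝ} (hℓ : 0 < ℓ) : Continuous (steepCut b ℓ) :=
  (lipschitzWith_steepCut hℓ).continuous

/-- `(χ(x) − χ(y))² ≤ min(1, (x − y)²/ℓ²)`. [folklore] -/
theorem sq_steepCut_sub_le {b ℓ : ℝ} (hℓ : 0 < ℓ) (x y : ℝ) :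
    (steepCut b ℓ x - steepCut b ℓ y) ^ 2 ≤ min 1 ((x - y) ^ 2 / ℓ ^ 2) := by
  refine le_min ?_ ?_
  · have h1 : |steepCut b ℓ x - steepCut b ℓ y| ≤ 1 := by
      rw [abs_le]
      constructor <;> linarith [(steepCut_mem b ℓ x).1, (steepCut_mem b ℓ x).2,
        (steepCut_mem b ℓ y).1, (steepCut_mem b ℓ y).2]
    calc (steepCut b ℓ x - steepCut b ℓ y) ^ 2 = |steepCut b ℓ x - steepCut b ℓ y| ^ 2 :=
          (sq_abs _).symm
      _ ≤ 1 ^ 2 := pow_le_pow_left₀ (abs_nonneg _) h1 2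
      _ = 1 := one_pow 2
  · calc (steepCut b ℓ x - steepCut b ℓ y) ^ 2 = |steepCut b ℓ x - steepCut b ℓ y| ^ 2 :=
          (sq_abs _).symm
      _ ≤ (|x - y| / ℓ) ^ 2 := pow_le_pow_left₀ (abs_nonneg _) (abs_steepCut_sub_le hℓ x y) 2
      _ = (x - y) ^ 2 / ℓ ^ 2 := by rw [div_pow, sq_abs]

/-! ## Normalisation with the pointwise edge law built in -/

/-- **Normalisation.** A ground state `u` of the window `a` with `‖u‖ ≤ K` a.e. and the pointwise
edge law `‖u x‖² log(1/(a−|x|)) ≤ K_P` a.e. on the layer `a − d₀ < |x| < a` has an a.e.-equal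
MEASURABLE modification vanishing off `(−a, a)`, bounded by `max K 0` everywhere, and obeying the
edge law with constant `max K_P 0` EVERYWHERE on that layer. [folklore] -/
theorem cut_normalise {a K KP d₀ : ℝ} {u : ℝ → ℂ} (hu : IsWeilGroundState a u)
    (hK : ∀ᵐ x : ℝ, ‖u x‖ ≤ K)
    (hP : ∀ᵐ x : ℝ, a - d₀ < |x| → |x| < a → ‖u x‖ ^ 2 * Real.log (1 / (a - |x|)) ≤ KP) :
    ∃ v : ℝ → ℂ, Measurable v ∧ v =ᵐ[volume] u ∧ (∀ x, x ∉ Ioo (-a) a → v x = 0) ∧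
      (∀ x, ‖v x‖ ≤ max K 0) ∧
      ∀ x, a - d₀ < |x| → |x| < a → ‖v x‖ ^ 2 * Real.log (1 / (a - |x|)) ≤ max KP 0 := by
  set u₁ : ℝ → ℂ := hu.memLp.1.mk u with hu₁
  have hu₁m : Measurable u₁ := hu.memLp.1.stronglyMeasurable_mk.measurable
  have hu₁ae : u =ᵐ[volume] u₁ := hu.memLp.1.ae_eq_mk
  set P : Set ℝ := {x | a - d₀ < |x|}ᶜ ∪ ({x : ℝ | |x| < a}ᶜ ∪
    {x | ‖u₁ x‖ ^ 2 * Real.log (1 / (a - |x|)) ≤ max KP 0}) with hPdef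
  have habs : Measurable fun x : ℝ ↦ |x| := continuous_abs.measurable
  have hPm : MeasurableSet P := by
    refine (measurableSet_lt measurable_const habs).compl.union
      ((measurableSet_lt habs measurable_const).compl.union (measurableSet_le ?_ measurable_const))
    exact (hu₁m.norm.pow_const 2).mul ((measurable_const.div (measurable_const.sub habs)).log)
  set S : Set ℝ := ({x | ‖u₁ x‖ ≤ max K 0} ∩ Ioo (-a) a) ∩ P with hS
  have hSm : MeasurableSet S :=
    ((measurableSet_le hu₁m.norm measurable_const).inter measurableSet_Ioo).inter hPm
  refine ⟨S.indicator u₁, hu₁m.indicator hSm, ?_, ?_, ?_, ?_⟩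
  · have hIoo : ∀ᵐ x : ℝ, x ∉ Ioo (-a) a → u x = 0 := by
      have hend : ∀ᵐ x : ℝ, x ≠ a ∧ x ≠ -a := by
        have h1 : ∀ᵐ x : ℝ, x ≠ a := by simp [ae_iff]
        have h2 : ∀ᵐ x : ℝ, x ≠ -a := by simp [ae_iff]
        filter_upwards [h1, h2] with x h1 h2 using ⟨h1, h2⟩
      filter_upwards [hu.ae_eq_zero_of_notMem, hend] with x hx hne hxI
      refine hx fun hIcc ↦ hxI ⟨lt_of_le_of_ne hIcc.1 (Ne.symm hne.2), lt_of_le_of_ne hIcc.2 hne.1⟩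
    filter_upwards [hu₁ae, hK, hP, hIoo] with x hx hxK hxP hx0
    by_cases hxI : x ∈ Ioo (-a) a
    · have hxS : x ∈ S := by
        refine ⟨⟨?_, hxI⟩, ?_⟩
        · show ‖u₁ x‖ ≤ max K 0
          rw [← hx]
          exact hxK.trans (le_max_left _ _)
        · by_cases h1 : a - d₀ < |x|
          · by_cases h2 : |x| < a
            · refine Or.inr (Or.inr ?_)
              show ‖u₁ x‖ ^ 2 * Real.log (1 / (a - |x|)) ≤ max KP 0
              rw [← hx]
              exact (hxP h1 h2).trans (le_max_left _ _)
            · exact Or.inr (Or.inl h2)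
          · exact Or.inl h1
      rw [indicator_of_mem hxS, hx]
    · have hxS : x ∉ S := fun h ↦ hxI h.1.2
      rw [indicator_of_notMem hxS, hx0 hxI]
  · intro x hx
    exact indicator_of_notMem (fun h ↦ hx h.1.2) _
  · intro x
    by_cases hxS : x ∈ S
    · rw [indicator_of_mem hxS]
      exact hxS.1.1
    · rw [indicator_of_notMem hxS, norm_zero]
      exact le_max_right _ _
  · intro x h1 h2
    by_cases hxS : x ∈ S
    · rw [indicator_of_mem hxS]
      rcases hxS.2 with h | h | h
      · exact absurd h1 h
      · exact absurd h2 h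
      · exact h
    · rw [indicator_of_notMem hxS, norm_zero]
      simp

/-! ## Two scalar lemmas for the majorant -/

/-- Young's inequality in the form used for the far singular zone:
`P Q/(2t) ≤ (α P² + Q²/α)/(4t)` for `α, t > 0`. [folklore] -/
theorem mul_div_two_mul_le_young {P Q α t : ℝ} (hα : 0 < α) (ht : 0 < t) :
    P * Q / (2 * t) ≤ (α * P ^ 2 + Q ^ 2 / α) / (4 * t) := by
  rw [div_le_div_iff₀ (by positivity) (by positivity)]
  have h : 0 ≤ (α * P - Q) ^ 2 / α := by positivity
  have h' : (α * P - Q) ^ 2 / α = α * P ^ 2 - 2 * (P * Q) + Q ^ 2 / α := by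
    field_simp
    ring
  nlinarith [h, h']

/-- From the pointwise edge law: `‖u y‖ ≤ √(K_P / L_s)` whenever `0 < a − |y| ≤ s < 1`, `s < d₀`...
precisely: if `‖u y‖² log(1/(a−|y|)) ≤ K_P` and `0 < a − |y|`, `a − |y| ≤ s`, `s < 1`, then
`‖u y‖ ≤ √(K_P/log(1/s))`. [folklore] -/
theorem norm_le_sqrt_div_log {u : ℝ → ℂ} {a KP s y : ℝ}
    (hlaw : ‖u y‖ ^ 2 * Real.log (1 / (a - |y|)) ≤ KP) (hpos : 0 < a - |y|) (hle : a - |y| ≤ s)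
    (hs1 : s < 1) : ‖u y‖ ≤ Real.sqrt (KP / Real.log (1 / s)) := by
  have hLs : 0 < Real.log (1 / s) := stub_surplusReduction_log_pos (hpos.trans_le hle) hs1
  have hLy : Real.log (1 / s) ≤ Real.log (1 / (a - |y|)) := by
    rw [one_div, Real.log_inv, one_div, Real.log_inv, neg_le_neg_iff]
    exact Real.log_le_log hpos hle
  have h1 : ‖u y‖ ^ 2 * Real.log (1 / s) ≤ KP :=
    (mul_le_mul_of_nonneg_left hLy (by positivity)).trans hlaw
  have h2 : ‖u y‖ ^ 2 ≤ KP / Real.log (1 / s) := by rwa [le_div_iff₀ hLs]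
  calc ‖u y‖ = Real.sqrt (‖u y‖ ^ 2) := (Real.sqrt_sq (norm_nonneg _)).symm
    _ ≤ Real.sqrt (KP / Real.log (1 / s)) := Real.sqrt_le_sqrt h2

end Summit.RiemannHypothesis.RiemannHypothesis.Theorems.PfPersistence

end
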